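import Summits.CriticalPhenomena.CardyFormulaZ2.Theorems.CardyBoundaryCoulombGasBoundaryDefectGaussianRS17DictionaryOfPart2
import Summits.CriticalPhenomena.CardyFormulaZ2.Theorems.CardyBoundaryCoulombGasBoundaryDefectGaussianRS17StrandTurningPart1
import Summits.CriticalPhenomena.CardyFormulaZ2.Theorems.CardyBoundaryCoulombGasBoundaryDefectGaussianRS17StrandTurningPart4
import Summits.CriticalPhenomena.CardyFormulaZ2.Theorems.CardyBoundaryCoulombGasBoundaryDefectGaussianRS17StrandTurningPart5

/-!
# Stub `s17_strandTurning` of line `rainbow-monomials-in-excursion-kernels` — Part 6 (final):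
# the turning number of a strand between two ends does not depend on the configuration
# (crux `BoundaryDefectGaussianR`, stmt-CriticalPhenomena-14132; insertion dictionary D2, T6)

In the Baxter–Kelland–Wu strand expansion of `Zins` each open strand of the completed configuration
`cfgOf ω` of the jump collar `ι.model V` carries the phase `exp(i ε (π/12) ∑ turnSign)`; the
dictionary needs the turning sum from a start corner `e` (the successor of a cut turn) to the first
cut `b` to be the SAME for every `ω ⊆ E` in which the strand from `e` reaches `b`. Proof
(`s17_strandTurning`, the registered stub): both strands are closed up by ONE common return walk —
the dart of `b`, then a shortest walk of darts of UNTRACKED corners from the head of that dart to the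
position of `e` (it exists: the head of the dart of a tracked cut and the position of a start are rim
points of the cell region, Part 5, joined through non-cells, Part 4) — into closed TRAILS of the
oriented medial graph (the strand corners are tracked, pairwise distinct and not cuts; the return
corners are untracked and distinct); the first return dart leaves the head of `b`'s dart, so one of
its sides is a cell of `b`'s dart (`MedialTrail.wedge`) and the other a NON-cell, on which the
difference of the partial winding numbers of the two strands vanishes (it is constant through
non-cells out to the far west, Parts 2/4); hence the two trails have the same orientation and the
same turning number `±4` (Umlaufsatz with winding sign, Part 1), i.e. the two strand sums agree.
Everything is proved; no new definitions.
-/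

namespace Summit.CriticalPhenomena.CardyFormulaZ2.Cruxes.BoundaryDefectGaussianR.RainbowMonomialsInExcursionKernels

open Literature.Probability.LatticeModels Literature.Probability.LatticeModels.CollarLegModel
open Literature.Probability.LatticeModels.MedialTrail
open Literature.Probability.Percolation Literature.Probability.Percolation.CellComplex

section Strand

variable {M : CollarLegModel} {ω : Finset ((ℤ × ℤ) × Bool)}

/-- The corners of a cut-free stretch of a strand from a tracked corner are tracked (successors of
non-cut corners are tracked, `dict_isTracked_nextCorner_of_not_isCut`). [folklore] -/
theorem s17_st6_tracked_iter (hω : ω ⊆ M.E) {e : Site 2 × Fin 4} (he : M.IsTracked e) {n : ℕ}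
    (hcut : ∀ m < n, ¬M.IsCut ((nextCorner (M.cfgOf ω))^[m] e)) : ∀ m ≤ n, M.IsTracked ((nextCorner (M.cfgOf ω))^[m] e) := by
  intro m
  induction m with
  | zero => exact fun _ => he
  | succ m ih =>
    intro hm
    rw [Function.iterate_succ_apply']
    exact dict_isTracked_nextCorner_of_not_isCut hω (hcut m hm)

/-- **The corners of a cut-free stretch of a strand starting right after a cut are pairwise
distinct** (a repetition would make the orbit periodic and put the cut inside the stretch).
[folklore] -/
theorem s17_st6_inj (hω : ω ⊆ M.E) {e c₀ : Site 2 × Fin 4} (hc₀ : M.IsCut c₀) (hc₀e : nextCorner (M.cfgOf ∅) c₀ = e)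
    {n : ℕ} (hcut : ∀ m < n, ¬M.IsCut ((nextCorner (M.cfgOf ω))^[m] e)) {i j : ℕ} (hi : i < n) (hj : j < n)
    (hEq : (nextCorner (M.cfgOf ω))^[i] e = (nextCorner (M.cfgOf ω))^[j] e) : i = j := by
  have hpe : nextCorner (M.cfgOf ω) c₀ = e := by rw [nextCorner_cfgOf_eq_of_not_targetsLive hω hc₀.1, hc₀e]
  by_contra hne
  rcases lt_or_gt_of_ne hne with hlt | hlt
  · have hpred := iterate_pred_eq (Nat.le_sub_of_add_le' hlt) (iterate_sub_eq_self hlt hEq) hpe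
    exact hcut (j - i - 1) (by omega) (by rw [hpred]; exact hc₀)
  · have hpred := iterate_pred_eq (Nat.le_sub_of_add_le' hlt) (iterate_sub_eq_self hlt hEq.symm) hpe
    exact hcut (i - j - 1) (by omega) (by rw [hpred]; exact hc₀)

/-- A western bound for the medial positions of tracked corners. [folklore] -/
theorem s17_st6_cpos_bound {c : Site 2 × Fin 4} (hc : M.IsTracked c) :
    -(∑ x ∈ M.vertexCells, (|x.1| + |x.2|)) - 1 ≤ (cpos c).1 := by
  have h1 := Finset.single_le_sum (f := fun x : ℤ × ℤ => |x.1| + |x.2|) (fun _ _ => by positivity) hc.1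
  have h2 := neg_abs_le (c.1 0)
  have h3 := neg_abs_le (c.1 1)
  have h4 := neg_one_le_cposOff_fst c.2
  simp only [ofSite] at h1
  simp only [cpos]
  linarith

/-- **The position of a start is a rim point.** If `e` is tracked and the successor of a cut `c₀` in
the completed configuration of `∅`, then some untracked corner with a cell on one side of its dart
starts or ends at the position of `e` (the cut itself if it is untracked, Part 5 otherwise). [folklore] -/
theorem s17_st6_rim_start {e c₀ : Site 2 × Fin 4} (he : M.IsTracked e) (hc₀e : nextCorner (M.cfgOf ∅) c₀ = e)
    (h5 : M.IsTracked c₀ → ∃ q : Site 2 × Fin 4, ¬M.IsTracked q ∧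
      (ofSite q.1 ∈ M.vertexCells ∨ ofSite (cFace q) ∈ M.faceCells) ∧ cpos q = cpos (nextCorner (M.cfgOf ∅) c₀)) :
    ∃ q : Site 2 × Fin 4, ¬M.IsTracked q ∧ (ofSite q.1 ∈ M.vertexCells ∨ ofSite (cFace q) ∈ M.faceCells) ∧
      (cpos q = cpos e ∨ (cornerDart q).2 = cpos e) := by
  by_cases htr : M.IsTracked c₀
  · obtain ⟨q, hq, hrim, hpos⟩ := h5 htr
    exact ⟨q, hq, hrim, Or.inl (by rw [hpos, hc₀e])⟩
  · refine ⟨c₀, htr, ?_, Or.inr (by rw [cornerDart_eq (M.cfgOf ∅), hc₀e])⟩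
    by_cases hm : cTgt c₀ ∈ M.cfgOf ∅
    · right
      rw [← cFace_nextCorner_of_mem hm, hc₀e]
      exact he.2
    · left
      rw [nextCorner_of_not_mem hm] at hc₀e
      rw [← hc₀e] at he
      exact he.1

end Strand

/-- **Stub `s17_strandTurning` (T6 of the insertion dictionary): the turning number of a strand
between two ends does not depend on the configuration.** For an admissible leg insertion `ι` on `V`
(flat insertion points, local charts, `V` lattice-connected with king-connected complement and
first-layer charts), a tracked corner `e` that is the successor of a cut turn and a tracked cut
corner `b` of the jump collar `ι.model V`: if in the completed configurations of `ω, ω' ⊆ E` the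
strand from `e` reaches `b` after `n`, resp. `n'`, turns none of which is a cut, then
`∑_{m<n} turnSign (cfgOf ω) (σ_ω^m e) = ∑_{m<n'} turnSign (cfgOf ω') (σ_{ω'}^m e)`.
[cite: BaxterKellandWu1976, §3–§4] -/
theorem s17_strandTurning : ∀ (ι : Literature.Probability.LatticeModels.CollarLegModel.LegInsertionData) (V : Finset (ℤ × ℤ)), ι.IsAdmissible V → (∀ x ∈ insert ι.sink ι.source, ∃ dvec : ℤ × ℤ, (dvec = (1, 0) ∨ dvec = (-1, 0) ∨ dvec = (0, 1) ∨ dvec = (0, -1)) ∧ ∀ v : ℤ × ℤ, (v.1 - x.1) ^ 2 + (v.2 - x.2) ^ 2 ≤ ((ι.sinkLegs : ℤ) + 4) ^ 2 → (v ∈ V ↔ 0 ≤ (v.1 - x.1) * dvec.1 + (v.2 - x.2) * dvec.2)) → (∀ u ∈ V, ∀ k : Fin 4, u + Literature.Probability.LatticeModels.CollarLegModel.dir k ∉ V → ∃ (K : Fin 4) (c₁ c₂ : ℤ), (∀ v : ℤ × ℤ, |v.1 - u.1| ≤ 3 → |v.2 - u.2| ≤ 3 → (v ∈ V ↔ c₂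 ≤ v.1 * (Literature.Probability.LatticeModels.CollarLegModel.dir (K + 1)).1 + v.2 * (Literature.Probability.LatticeModels.CollarLegModel.dir (K + 1)).2)) ∨ (∀ v : ℤ × ℤ, |v.1 - u.1| ≤ 3 → |v.2 - u.2| ≤ 3 → (v ∈ V ↔ c₁ ≤ v.1 * (Literature.Probability.LatticeModels.CollarLegModel.dir K).1 + v.2 * (Literature.Probability.LatticeModels.CollarLegModel.dir K).2 ∧ c₂ ≤ v.1 * (Literature.Probability.LatticeModels.CollarLegModel.dir (K + 1)).1 + v.2 * (Literature.Probability.LatticeModels.CollarLegModel.dir (K + 1)).2)) ∨ (∀ v : ℤ × ℤ, |v.1 - u.1| ≤ 3 → |v.2 - u.2| ≤ 3 → (v ∈ V ↔ c₂ ≤ v.1 * (Literature.Probability.LatticeModels.CollarLegModel.dir (K + 1)).1 + v.2 * (Literature.Probability.LatticeModels.CollarLegModel.dir (K + 1)).2 ∨ v.1 * (Literature.Probability.LatticeModels.CollarLegModel.dir K).1 + v.2 * (Literature.Probability.LatticeModels.CollarLegModel.dir K).2 ≤ c₁))) → (∀ u ∈ V, ∀ w ∈ V, Relation.ReflTransGen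 (fun b c : ℤ × ℤ ↦ b ∈ V ∧ c ∈ V ∧ (b.1 - c.1) ^ 2 + (b.2 - c.2) ^ 2 = 1) u w) → (∀ u ∉ V, ∀ w ∉ V, Relation.ReflTransGen (fun b c : ℤ × ℤ ↦ b ∉ V ∧ c ∉ V ∧ max |b.1 - c.1| |b.2 - c.2| ≤ 1) u w) → (∀ z : ℤ × ℤ, z ∉ V → (∃ v ∈ V, max |v.1 - z.1| |v.2 - z.2| ≤ 1) → ∃ σ τ a c : ℤ, |σ| ≤ 1 ∧ |τ| ≤ 1 ∧ ((∀ v : ℤ × ℤ, max |v.1 - z.1| |v.2 - z.2| ≤ 6 → (v ∈ V ↔ 0 ≤ σ * (v.1 - a) ∧ 0 ≤ τ * (v.2 - c))) ∨ (∀ v : ℤ × ℤ, max |v.1 - z.1| |v.2 - z.2| ≤ 6 → (v ∈ V ↔ 0 < σ * (v.1 - a) ∨ 0 < τ * (v.2 - c))))) → ∀ (ω ω' : Finset ((ℤ × ℤ) × Bool)), ω ⊆ (ι.model V).E → ω' ⊆ (ι.model V).E → ∀ (e b : Literature.Probability.LatticeModels.Site 2 × Fin 4), (ι.model V).IsTracked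 e → (∃ c₀, (ι.model V).IsCut c₀ ∧ Literature.Probability.LatticeModels.nextCorner ((ι.model V).cfgOf ∅) c₀ = e) → (ι.model V).IsTracked b → (ι.model V).IsCut b → ∀ (n n' : ℕ), (Literature.Probability.LatticeModels.nextCorner ((ι.model V).cfgOf ω))^[n] e = b → (∀ m < n, ¬(ι.model V).IsCut ((Literature.Probability.LatticeModels.nextCorner ((ι.model V).cfgOf ω))^[m] e)) → (Literature.Probability.LatticeModels.nextCorner ((ι.model V).cfgOf ω'))^[n'] e = b → (∀ m < n', ¬(ι.model V).IsCut ((Literature.Probability.LatticeModels.nextCorner ((ι.model V).cfgOf ω'))^[m] e)) → ∑ m ∈ Finset.range n, Literature.Probability.LatticeModels.turnSign ((ι.model V).cfgOf ω) ((Literature.Probability.LatticeModels.nextCorner ((ι.model V).cfgOf ω))^[m] e) = ∑ m ∈ Finset.range n', Literature.Probability.LatticeModels.turnSign ((ι.model V).cfgOf ω') ((Literature.Probability.LatticeModels.nextCorner ((ι.model V).cfgOf ω'))^[m] e) := by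
  intro ι V hadm hflat hchart _ hK hLS ω ω' hω hω' e b he hc₀ hb hbcut n n' hAn hAcut hBn hBcut
  obtain ⟨c₀, hc₀cut, hc₀e⟩ := hc₀
  -- flatness at the smaller radius used by the strand-end lemmas
  have hflat3 : ∀ x ∈ insert ι.sink ι.source, ∃ dvec : ℤ × ℤ, (dvec = (1, 0) ∨ dvec = (-1, 0) ∨ dvec = (0, 1) ∨ dvec = (0, -1)) ∧
      ∀ v : ℤ × ℤ, (v.1 - x.1) ^ 2 + (v.2 - x.2) ^ 2 ≤ ((ι.sinkLegs : ℤ) + 3) ^ 2 →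
        (v ∈ V ↔ 0 ≤ (v.1 - x.1) * dvec.1 + (v.2 - x.2) * dvec.2) := by
    intro x hx
    obtain ⟨dvec, hd, hfl⟩ := hflat x hx
    refine ⟨dvec, hd, fun v hv => hfl v (hv.trans ?_)⟩
    have h0 : (0 : ℤ) ≤ ι.sinkLegs := Nat.cast_nonneg _
    nlinarith
  -- degenerate stretches: `n = 0` iff `n' = 0`
  rcases Nat.eq_zero_or_pos n with hn0 | hn
  · subst hn0
    rcases Nat.eq_zero_or_pos n' with hn0' | hn'
    · subst hn0'; rfl
    · have heb : e = b := hAn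
      exact absurd (show (ι.model V).IsCut e from heb ▸ hbcut) (hBcut 0 hn')
  rcases Nat.eq_zero_or_pos n' with hn0' | hn'
  · subst hn0'
    have heb : e = b := hBn
    exact absurd (show (ι.model V).IsCut e from heb ▸ hbcut) (hAcut 0 hn)
  -- the strands are tracked and injective
  have htrA := s17_st6_tracked_iter hω he hAcut
  have htrB := s17_st6_tracked_iter hω' he hBcut
  -- Part 5 at `b`: closed target, rim point at the head of its dart
  obtain ⟨-, hnextb, qb, hqb, hqbrim, hqbpos⟩ := s17_strandTurning_part5 ι V hadm hflat3 hchart b hb hbcut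
  have hP₁ : cpos qb = (cornerDart b).2 := by
    rw [hqbpos, cornerDart_eq ((ι.model V).cfgOf ∅)]
  -- the return walk: untracked, no repeated corner, from the head of `b`'s dart to the position of `e`
  obtain ⟨cs, hnd, hcs0, huntr, hchain, hhd, hlst⟩ := s17_strandTurning_part4 (ι.model V) hK hLS (cornerDart b).2 (cpos e)
    ⟨qb, hqb, hqbrim, Or.inl hP₁⟩
    (s17_st6_rim_start he hc₀e fun htr => (s17_strandTurning_part5 ι V hadm hflat3 hchart c₀ htr hc₀cut).2.2)
  obtain ⟨c₁, cs', rfl⟩ := List.exists_cons_of_ne_nil hcs0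
  have hc₁P : cpos c₁ = (cornerDart b).2 := hhd c₁ rfl
  have hc₁nt : ¬(ι.model V).IsTracked c₁ := huntr c₁ (by simp)
  -- hypotheses of Part 1 for the return list `b :: c₁ :: cs'`
  have hhead : (b :: c₁ :: cs').head? = some ((nextCorner ((ι.model V).cfgOf ω))^[n] e) := by rw [hAn]; rfl
  have hchain' : List.IsChain (fun c c' : Site 2 × Fin 4 => (cornerDart c).2 = cpos c') (b :: c₁ :: cs') :=
    List.IsChain.cons_cons hc₁P.symm hchain
  have hlast : ∀ c, (b :: c₁ :: cs').getLast? = some c → (cornerDart c).2 = cpos e := fun c hc => by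
    rw [List.getLast?_cons_cons] at hc; exact hlst c hc
  have hR : ((b :: c₁ :: cs').map cornerDart).Nodup := by
    rw [List.map_cons, List.nodup_cons]
    refine ⟨fun hm => ?_, hnd.map cornerDart_injective⟩
    rw [List.mem_map] at hm
    obtain ⟨c, hc, hcb⟩ := hm
    exact huntr c hc (cornerDart_injective hcb ▸ hb)
  have hnodup : ∀ (ω₁ : Finset ((ℤ × ℤ) × Bool)) (n₁ : ℕ), ω₁ ⊆ (ι.model V).E →
      (nextCorner ((ι.model V).cfgOf ω₁))^[n₁] e = b → (∀ m < n₁, ¬(ι.model V).IsCut ((nextCorner ((ι.model V).cfgOf ω₁))^[m] e)) →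
      ((List.range n₁).map (fun m => cornerDart ((nextCorner ((ι.model V).cfgOf ω₁))^[m] e)) ++
        (b :: c₁ :: cs').map cornerDart).Nodup := by
    intro ω₁ n₁ hω₁ hn₁ hcut₁
    have htr₁ := s17_st6_tracked_iter hω₁ he hcut₁
    rw [List.nodup_append]
    refine ⟨List.Nodup.map_on (fun i hi j hj hij => ?_) List.nodup_range, hR, fun s hs s' hs' hss' => ?_⟩
    · rw [List.mem_range] at hi hj
      exact s17_st6_inj hω₁ hc₀cut hc₀e hcut₁ hi hj (cornerDart_injective hij)
    · subst hss'
      rw [List.mem_map] at hs hs'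
      obtain ⟨m, hm, rfl⟩ := hs
      rw [List.mem_range] at hm
      obtain ⟨c, hc, hcm⟩ := hs'
      have hcm' := cornerDart_injective hcm
      rcases List.mem_cons.1 hc with rfl | hc
      · exact hcut₁ m hm (hcm' ▸ hbcut)
      · exact huntr c hc (hcm' ▸ htr₁ m hm.le)
  -- the first return dart has a cell of `b`'s dart on one side and a non-cell on the other
  have e1 : cornerDart b = (cpos b, cpos c₁) := Prod.ext rfl hc₁P.symm
  have e2 : cornerDart c₁ = (cpos c₁, (cornerDart c₁).2) := Prod.ext rfl rfl
  have hw : lf (cornerDart b) = lf (cornerDart c₁) ∨ rf (cornerDart b) = rf (cornerDart c₁) := by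
    have h1 := isDart_cornerDart b
    have h2 := isDart_cornerDart c₁
    rw [e1] at h1
    rw [e2] at h2
    rw [e1, e2]
    exact wedge h1 h2
  have hbtr := ((ι.model V).isTracked_iff_cornerDart b).1 hb
  have hc₁' : ¬(lf (cornerDart c₁) ∈ (ι.model V).cellRegion ∧ rf (cornerDart c₁) ∈ (ι.model V).cellRegion) :=
    fun h => hc₁nt (((ι.model V).isTracked_iff_cornerDart c₁).2 h)
  obtain ⟨G, C, hGside, hG, hC, hadjGC⟩ : ∃ G C : Pt, (G = lf (cornerDart c₁) ∨ G = rf (cornerDart c₁)) ∧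
      G ∉ (ι.model V).cellRegion ∧ C ∈ (ι.model V).cellRegion ∧
      CellAdj (![C.1, C.2] : Fin 2 → ℤ) (![G.1, G.2] : Fin 2 → ℤ) := by
    rcases hw with hw | hw
    · refine ⟨rf (cornerDart c₁), lf (cornerDart c₁), Or.inr rfl, fun h => hc₁' ⟨hw ▸ hbtr.1, h⟩, hw ▸ hbtr.1, ?_⟩
      rw [s17_st4_sides_adj]; exact crr_cellAdj_add_unit _ _
    · refine ⟨lf (cornerDart c₁), rf (cornerDart c₁), Or.inl rfl, fun h => hc₁' ⟨h, hw ▸ hbtr.2⟩, hw ▸ hbtr.2, ?_⟩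
      rw [s17_st4_sides_adj]; exact (crr_cellAdj_add_unit _ _).symm
  have ho : (![G.1, G.2] : Fin 2 → ℤ) ∉ (ι.model V).cellRegion.image (fun F : ℤ × ℤ ↦ (![F.1, F.2] : Fin 2 → ℤ)) :=
    fun h => hG ((s17_st4_mem_U_iff _ G).1 h)
  have hCU : (![C.1, C.2] : Fin 2 → ℤ) ∈ (ι.model V).cellRegion.image (fun F : ℤ × ℤ ↦ (![F.1, F.2] : Fin 2 → ℤ)) :=
    (s17_st4_mem_U_iff _ C).2 hC
  -- escape through non-cells to the far west
  obtain ⟨o', ho'X, hesc⟩ := s17_st4_escape (ι.model V) hK hLS ho ⟨_, hCU, hadjGC⟩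
    (-(∑ x ∈ (ι.model V).vertexCells, (|x.1| + |x.2|)) - 1)
  -- the two strand dart lists, as dart paths
  have eqD : ∀ (ω₁ : Finset ((ℤ × ℤ) × Bool)) (n₁ : ℕ),
      (List.range n₁).map (fun m => cornerDart ((nextCorner ((ι.model V).cfgOf ω₁))^[m] e)) =
      (List.range n₁).map (fun m => (cpos ((nextCorner ((ι.model V).cfgOf ω₁))^[m] e),
        cpos ((nextCorner ((ι.model V).cfgOf ω₁))^[m + 1] e))) := fun ω₁ n₁ =>
    List.map_congr_left fun m _ => by rw [cornerDart_eq ((ι.model V).cfgOf ω₁), Function.iterate_succ_apply']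
  have hDt : ∀ (ω₁ : Finset ((ℤ × ℤ) × Bool)) (n₁ : ℕ), (∀ m ≤ n₁, (ι.model V).IsTracked ((nextCorner ((ι.model V).cfgOf ω₁))^[m] e)) →
      ∀ s ∈ (List.range n₁).map (fun m => (cpos ((nextCorner ((ι.model V).cfgOf ω₁))^[m] e),
        cpos ((nextCorner ((ι.model V).cfgOf ω₁))^[m + 1] e))), ∃ c, (ι.model V).IsTracked c ∧ s = cornerDart c := by
    intro ω₁ n₁ htr₁ s hs
    rw [← eqD, List.mem_map] at hs
    obtain ⟨m, hm, rfl⟩ := hs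
    exact ⟨_, htr₁ m (List.mem_range.1 hm).le, rfl⟩
  have hdc := s17_st4_dartChain (ι.model V) _ _ (hDt ω n htrA) (hDt ω' n' htrB) hesc
  have hG0 : (((![G.1, G.2] : Fin 2 → ℤ) 0, (![G.1, G.2] : Fin 2 → ℤ) 1) : Pt) = G := by simp
  rw [hG0] at hdc
  have hΔ := s17_strandTurning_part2 (fun m => cpos ((nextCorner ((ι.model V).cfgOf ω))^[m] e))
    (fun m => cpos ((nextCorner ((ι.model V).cfgOf ω'))^[m] e)) n n' rfl (by simp only [hAn, hBn])
    (fun m _ => by simp only [Function.iterate_succ_apply']; exact isDart_cpos _ _)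
    (fun m _ => by simp only [Function.iterate_succ_apply']; exact isDart_cpos _ _) G (o' 0, o' 1) hdc
    (fun m hm => lt_of_lt_of_le ho'X (s17_st6_cpos_bound (htrA m hm)))
    (fun m hm => lt_of_lt_of_le ho'X (s17_st6_cpos_bound (htrB m hm)))
  rw [← eqD, ← eqD] at hΔ
  -- Part 1
  exact s17_strandTurning_part1 ((ι.model V).cfgOf ω) ((ι.model V).cfgOf ω') e n n' (b :: c₁ :: cs') hn hn'
    (hAn.trans hBn.symm) hhead hchain' hlast (hnodup ω n hω hAn hAcut) (hnodup ω' n' hω' hBn hBcut)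
    ⟨c₁, by simp, G, hGside, sub_eq_zero.1 hΔ⟩

end Summit.CriticalPhenomena.CardyFormulaZ2.Cruxes.BoundaryDefectGaussianR.RainbowMonomialsInExcursionKernels
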